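import Summits.ABC.IUTFork.Repair.RHSzpiroBadCutFreyFamily3
import Summits.ABC.IUTFork.Cor312SzpiroBadVsDepthPoint
import Literature.IUT.LogVolume.Corollary22RatPointDictionary
import Literature.IUT.LogVolume.Corollary22PartIIUpTo
import Literature.NumberTheory.DiophantineGeometry.GenEllThm21
import HarnessLib

/-!
# R-H ROUND 1 row 2 «szpiro-bad-datum-cut», ROUND-2 KERNEL RESIDUE: `H⋆₂ = HStarSzpiroBadCut` is refuted MODULO exactly (P6) and the
# existence of ONE Θ-volume datum, at the admissible Szpiro-bad Frey point `14321927484375 + 101029508532509551847 = 101029522854437036222`,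
# `l ∈ {11, 13}` — every other antecedent of `H⋆₂` discharged in the kernel; plus an `l`-SHARP window criterion

PROOF-ONLY file (0 definitions, no instance, no notation) of the abc-iut cell (D-0079 rescue sub-cell R-H, seat abc-iut-rh-typ-2 gen 2; sequel to
`RHSzpiroBadCut.lean` p457441, `RHSzpiroBadCutReyssat.lean` p461207/p461574, `RHSzpiroBadCutFreyFamily{,2,3,4}.lean` p462474…p463218 of gen 0).
TAKES NO SIDE on [IUTchIII] Cor. 3.12 or on any author. The row-2 verdict of `plan/rescue/R-H/ROUND1.tsv` (KILL(k1), 0/131 Szpiro-bad data)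
already has a kernel NEG theorem `not_i06StarCellsAt_F<nn>_l<l>` for each of the 133 Szpiro-bad Frey data of R-W's WINDOW-TABLE; gen 0's HANDOFF §3
named the three NON-kernel inputs still separating those from an unconditional `¬ HStarSzpiroBadCut`: (M2) the Szpiro-bad disjunction of the cut
certificate p450130 IN KERNEL at a Frey point, (M3) admissibility there (`UP`, `AdmitsCore`, (P2), (P5), (P6)), (M4) existence of a Θ-volume datum in
the window there. THIS FILE (§1–§2, generic) and its sequel `RHSzpiroBadCutFreyResidueF18.lean` (§3, the instance) discharge (M2) and (M3)
except (P6), and the window half of (M4), at ONE point: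

* §1 `one_le_depthProduct_of_neg_mul_le` / `not_deepOrd_of_neg_ord_jE_mul_le` / `not_deep_of_neg_ord_jE_mul_le` /
  `neg_ord_jE_mul_le_of_forall_localHeight_mul_le` / `not_deep_of_forall_localHeight_mul_le` — an `l`-SHARP form of R-W's uniform WINDOW criterion
  (abc-iut-w4-d078 p457542 `GenuineK.not_deepOrd_of_neg_ord_jE_le`: every bad `−ord_{x₀}(j_E) ≤ 16·e_{x₀}` ⟹ never deep): the constant `16` becomes
  `8l(2l+3)/((l−3)(l+1))` (`= 21.5…` at `l = 13`, `22.9…` at `l = 11`, `↘ 16` as `l → ∞`), from the exact label range `i ≤ l⋆ − 1 = (l−3)/2` (at the top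
  label `(4i+9)·l = 8((i+1)²−1)` is replaced by `(4i+9)(l−3)(l+1) ≥ 4(2l+3)·i(i+2)`, an identity in `l − (2i+3) ≥ 0`); point form: every bad `h_v` of
  `F_tpd` with `h_v·(l−3)(l+1) ≤ 8l(2l+3)·e_v` ⟹ EVERY Θ-volume datum at `(P, l)` satisfies the window guard (¬deep) of p450130 / `H⋆₂` VERBATIM.
* §2 at a RATIONAL point with reduced odd pole divisor (`j(q) = N/∏_{p∈I} p^{e_p}`, `p ∤ N` odd on `I`; abc-iut-c312-d1's dictionary p462751 BY NAME):
  `condP2_ratPoint_of_factorisation` ((P2) ⟸ `l ∤ e_p` on `I`), `condP5_ratPoint_of_factorisation` ((P5) ⟸ some `p ∈ I ∖ {l}`),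
  `localHeight_mul_le_ratPoint_of_factorisation` (the §1 window hypothesis ⟸ `e_p·(l−3)(l+1) ≤ 8l(2l+3)` on `I`), and
  **`szpiroBad_ratPoint_of_certificate`** — the Szpiro-bad disjunction of p450130 at `(ratPoint q, l)` from ONE inequality of natural numbers
  `(∏_{I∖{l}} p)^A · 4^B < ∏_{I∖{l}} p^{e_p}` with `6(l+1)(l−1) ≤ A(l+4)(l−3)`, `6l(l+5) ≤ B(l+4)(l−3)` (`d_mod = 1`, `log-diff = 0`, `log π < log 4`,
  exact `log q^{∤2l}` / `log 𝔣^{∤2l}` sums of the dictionary).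
* §3 (sequel file) THE POINT `λ₁₈ = 14321927484375/101029522854437036222` (R-W triple F18 = `3·5⁶·7⁸·53 + 167⁹ = 2·11⁶·193⁴·20551`; `j(λ₁₈) = 2⁶(cb+a²)³/(abc/2)²`, odd
  poles `I = {3,5,7,11,53,167,193,20551}` with `h_p = 2v_p(abc) = (2,12,16,12,2,18,8,2)`, the place over `2` GOOD (`v₂(abc) = 1 ≤ 4`), `max h_p = 18`):
  `ratPoint λ₁₈ ∈ UP`, `AdmitsCore`, (P2) and (P5) at `l = 11, 13`, SZPIRO-BAD at `l = 11, 13` (certificates `rad'^6·4^9 < ∏ p^{h_p}`, margins 31.0 / 48.2),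
  every Θ-volume datum at `(λ₁₈, 11)` / `(λ₁₈, 13)` in the WINDOW (`18·8·12 ≤ 8·11·25`, `18·10·14 ≤ 8·13·29`); hence, with gen 0's kernel NEGs
  `not_i06StarCellsAt_F18_l11/_l13` (p462765): **`isEmpty_thetaVolumeDatumAt_F18_l13_of_hStar`** / `_l11_`: `HStarSzpiroBadCut ∧ CondP6 ⟹ NO Θ-volume
  datum exists at (λ₁₈, l)`, and **`not_hStarSzpiroBadCut_of_condP6_of_nonempty_F18_l13`** / `_l11`: `CondP6 ∧ Nonempty (ThetaVolumeDatumAt λ₁₈ l) ⟹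
  ¬ HStarSzpiroBadCut` — `¬H⋆₂` MODULO exactly the two campaign-S inputs (P6) ([IUTchI] Def. 3.1 (c) Galois image ⊇ SL₂(𝔽_l)) and (P7)-existence
  ([IUTchIV] Cor. 2.2 (ii) proof p. 46 «there exist data C̲_K, V̲, ε̲ …»), both of which [IUTchIV] itself asserts at such a point.
HONEST FRAMING: `HStarSzpiroBadCut`, `I06StarCellsAt`, `CondP6` are hypotheses / predicates, never asserted; NOTHING here asserts that abc is proved
or refuted, that Θ-data exist, or takes a side on [IUTchIII] Cor. 3.12 or on any author; typed ≠ proved; refuted-as-typed ≠ refuted-in-print.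
[cite: Mochizuki2012, IUTchI Def. 3.1 (b)(c) p. 61–62; IUTchIII Cor. 3.12 p. 173–174, Rmk. 3.12.2 (ii) p. 191; IUTchIV Prop. 1.2 (i) p. 10, Thm. 1.10 p. 22–23,
Cor. 2.2 (ii) proof (P2)(P5)(P6)(P7) p. 45–46] [cite: MochizukiGenEll2010, Ex. 1.3 (i) p. 5, Def. 3.3 p. 12] [cite: DupuyHilado2025, §3.3, §3.4]
[cite: SilvermanAEC2009, Prop. III.1.7(b)] [claim: Mochizuki2012, status: disputed] for every IUT locution. Axioms: standard.
-/

noncomputable section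

open Set Function NumberField IsDedekindDomain
open scoped Pointwise

/-! ## §1. The `l`-sharp WINDOW criterion (per packet, per datum, per point) -/

namespace Summit.ABC.IUTFork.Repair.RHSzpiroBadCutFreyResidue

open Thm311 Thm311.Real Cor312 Cor312Vol Cor312Prov Literature.IUT.LogThetaLattice Literature.IUT.LogVolume
  Literature.IUT.HodgeTheaters Literature.IUT.LogVolume.ThetaData Literature.AnabelianGeometry.AbsoluteAnabelian
open Literature.NumberTheory.DiophantineGeometry.GenEll Summit.ABC.IUTFork.Conditional
open Summit.ABC.IUTFork.Repair.RHSzpiroBadCut Summit.ABC.IUTFork.Repair.RHSzpiroBadCutFreyFamily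

/-- **The arithmetic of one packet, `l`-sharp.** For `p > 1`, `L ≥ 0`, `e ≥ 0`, `l ≥ 5`, an integer `o` with `(−o)·(l−3)(l+1) ≤ 8l(2l+3)·e` and a
label index `i` with `2i + 3 ≤ l`, the degree-form product `p^{((i+2)(4+2L))+1} · (p^{o/(2l·e)})^{(i+1)²−1}` is `≥ 1`: its exponent is
`≥ (4i+9) − (−o)·i(i+2)/(2le) ≥ 0`, because `(4i+9)(l−3)(l+1) − 4(2l+3)·i(i+2) = (4i+9)x² + (8i²+36i+36)x ≥ 0` for `x = l − (2i+3) ≥ 0`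
(`e = 0`: the inner exponent is `0` by `x/0 = 0`). Sharpens abc-iut-w4-d078's `GenuineK.one_le_depthProduct_of_neg_le` (constant `16`). [folklore] -/
theorem one_le_depthProduct_of_neg_mul_le {p L e : ℝ} {o : ℤ} {i lN : ℕ} (hp : 1 < p) (hL : 0 ≤ L) (he : 0 ≤ e) (h5 : 5 ≤ lN)
    (ho : (-(o : ℝ)) * (((lN : ℝ) - 3) * ((lN : ℝ) + 1)) ≤ 8 * (lN : ℝ) * (2 * (lN : ℝ) + 3) * e)
    (hil : 2 * (i : ℝ) + 3 ≤ (lN : ℝ)) :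
    1 ≤ p ^ ((((i : ℕ) : ℝ) + 2) * (4 + 2 * L) + 1) * (p ^ ((o : ℝ) / (2 * (lN : ℝ) * e))) ^ (((i : ℕ) + 1) ^ 2 - 1) := by
  have hp0 : 0 < p := by linarith
  have hl5 : (5 : ℝ) ≤ lN := by exact_mod_cast h5
  have hi0 : (0 : ℝ) ≤ i := Nat.cast_nonneg _
  have hn : ((((i : ℕ) + 1) ^ 2 - 1 : ℕ) : ℝ) = ((i : ℝ) + 1) ^ 2 - 1 := by
    rw [Nat.cast_sub (Nat.one_le_pow _ _ (Nat.succ_pos _))]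
    push_cast
    ring
  rw [← Real.rpow_natCast (p ^ ((o : ℝ) / (2 * (lN : ℝ) * e))) (((i : ℕ) + 1) ^ 2 - 1),
    ← Real.rpow_mul hp0.le, ← Real.rpow_add hp0, hn]
  refine Real.one_le_rpow hp.le ?_
  have hA : 4 * (i : ℝ) + 9 ≤ (((i : ℕ) : ℝ) + 2) * (4 + 2 * L) + 1 := by
    nlinarith [Nat.cast_nonneg (α := ℝ) i]
  have hB : -(4 * (i : ℝ) + 9) ≤ (o : ℝ) / (2 * (lN : ℝ) * e) * (((i : ℝ) + 1) ^ 2 - 1) := by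
    have hn0 : (0 : ℝ) ≤ ((i : ℝ) + 1) ^ 2 - 1 := by nlinarith
    have hM : (0 : ℝ) < ((lN : ℝ) - 3) * ((lN : ℝ) + 1) := by nlinarith
    rcases he.eq_or_lt with he0 | he0
    · rw [← he0, mul_zero, div_zero, zero_mul]
      linarith
    by_cases hoo : (0 : ℝ) ≤ (o : ℝ)
    · have : 0 ≤ (o : ℝ) / (2 * (lN : ℝ) * e) * (((i : ℝ) + 1) ^ 2 - 1) :=
        mul_nonneg (div_nonneg hoo (by positivity)) hn0
      linarith
    push Not at hoo
    -- `(4i+9)(l−3)(l+1) ≥ 4(2l+3)·i(i+2)` for `l ≥ 2i+3`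
    have hF : 4 * (2 * (lN : ℝ) + 3) * ((i : ℝ) * ((i : ℝ) + 2)) ≤ (4 * (i : ℝ) + 9) * (((lN : ℝ) - 3) * ((lN : ℝ) + 1)) := by
      have hx0 : 0 ≤ (lN : ℝ) - (2 * (i : ℝ) + 3) := by linarith
      have e1 : (4 * (i : ℝ) + 9) * (((lN : ℝ) - 3) * ((lN : ℝ) + 1)) - 4 * (2 * (lN : ℝ) + 3) * ((i : ℝ) * ((i : ℝ) + 2))
          = (4 * (i : ℝ) + 9) * ((lN : ℝ) - (2 * (i : ℝ) + 3)) ^ 2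
            + (8 * (i : ℝ) ^ 2 + 36 * (i : ℝ) + 36) * ((lN : ℝ) - (2 * (i : ℝ) + 3)) := by ring
      nlinarith [mul_nonneg (by positivity : (0 : ℝ) ≤ 4 * (i : ℝ) + 9) (sq_nonneg ((lN : ℝ) - (2 * (i : ℝ) + 3))),
        mul_nonneg (by positivity : (0 : ℝ) ≤ 8 * (i : ℝ) ^ 2 + 36 * (i : ℝ) + 36) hx0]
    -- `(−o)·i(i+2)·M ≤ i(i+2)·8l(2l+3)e ≤ 2le(4i+9)·M`
    have h1 : (-(o : ℝ)) * ((i : ℝ) * ((i : ℝ) + 2)) * (((lN : ℝ) - 3) * ((lN : ℝ) + 1)) ≤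
        2 * (lN : ℝ) * e * (4 * (i : ℝ) + 9) * (((lN : ℝ) - 3) * ((lN : ℝ) + 1)) := by
      have hii : (0 : ℝ) ≤ (i : ℝ) * ((i : ℝ) + 2) := by positivity
      calc (-(o : ℝ)) * ((i : ℝ) * ((i : ℝ) + 2)) * (((lN : ℝ) - 3) * ((lN : ℝ) + 1))
          = ((i : ℝ) * ((i : ℝ) + 2)) * ((-(o : ℝ)) * (((lN : ℝ) - 3) * ((lN : ℝ) + 1))) := by ring
        _ ≤ ((i : ℝ) * ((i : ℝ) + 2)) * (8 * (lN : ℝ) * (2 * (lN : ℝ) + 3) * e) := mul_le_mul_of_nonneg_left ho hii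
        _ = (2 * (lN : ℝ) * e) * (4 * (2 * (lN : ℝ) + 3) * ((i : ℝ) * ((i : ℝ) + 2))) := by ring
        _ ≤ (2 * (lN : ℝ) * e) * ((4 * (i : ℝ) + 9) * (((lN : ℝ) - 3) * ((lN : ℝ) + 1))) :=
            mul_le_mul_of_nonneg_left hF (by positivity)
        _ = 2 * (lN : ℝ) * e * (4 * (i : ℝ) + 9) * (((lN : ℝ) - 3) * ((lN : ℝ) + 1)) := by ring
    have h2 : (-(o : ℝ)) * ((i : ℝ) * ((i : ℝ) + 2)) ≤ 2 * (lN : ℝ) * e * (4 * (i : ℝ) + 9) :=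
      le_of_mul_le_mul_right h1 hM
    have h2le : (0 : ℝ) < 2 * (lN : ℝ) * e := by positivity
    have hrew : (o : ℝ) / (2 * (lN : ℝ) * e) * (((i : ℝ) + 1) ^ 2 - 1) =
        -((-(o : ℝ)) * ((i : ℝ) * ((i : ℝ) + 2)) / (2 * (lN : ℝ) * e)) := by
      field_simp
      ring
    rw [hrew, neg_le_neg_iff, div_le_iff₀ h2le]
    linarith
  linarith

section PerDatum

variable {F K Fbar : Type} [Field F] [NumberField F] [Field K] [NumberField K] [Algebra F K] [Field Fbar]
  [Algebra F Fbar] [Algebra K Fbar] {E : WeierstrassCurve F} [E.IsElliptic] {l : ℕ} {Pb : BadPlacePredicates K}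
  (D : InitialThetaData F K Fbar E l Pb)

/-- **`l`-SHARP WINDOW criterion, `DeepOrd` form** (R-W lane U): for an initial Θ-datum `D` over `K`, if EVERY bad place `x₀` of `K` over a prime
has `(−ord_{x₀}(j_E))·(l−3)(l+1) ≤ 8l(2l+3)·e_{x₀}`, then the datum-only depth predicate `DeepOrd(D)` (right-hand side of abc-iut-C-cert-2's
`GenuineK.deep_iff_deepOrd`, p445646, VERBATIM) FAILS, whatever `[K:ℚ]` is (`log_p[K:ℚ] ≥ 0` only raises the bar). Sharpens
`GenuineK.not_deepOrd_of_neg_ord_jE_le` (`16·e_{x₀}`). [cite: Mochizuki2012, IUTchIV Thm. 1.10 p. 22–23; IUTchIII Cor. 3.12 p. 173–174]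
[cite: DupuyHilado2025, §3.3, §3.4] [claim: Mochizuki2012, status: disputed] -/
theorem not_deepOrd_of_neg_ord_jE_mul_le
    (hw : ∀ (pp : Nat.Primes) (x₀ : (thetaIndex (pilotDataOfK D K)).Fibre (.inr pp)),
      haveI : Fact (pp : ℕ).Prime := ⟨pp.2⟩
      placeOf (pilotDataOfK D K) pp.1 x₀ ∈ (pilotDataOfK D K).S →
        (-(ord K (placeOf (pilotDataOfK D K) pp.1 x₀) (algebraMap F K E.j) : ℝ)) * (((l : ℝ) - 3) * ((l : ℝ) + 1)) ≤
          8 * (l : ℝ) * (2 * (l : ℝ) + 3) * ramIdx K (placeOf (pilotDataOfK D K) pp.1 x₀)) :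
    ¬ (∃ (pp : Nat.Primes) (_ : 2 < (pp : ℕ)) (i : Fin (thetaIndex (pilotDataOfK D K)).lstar)
        (x₀ : (thetaIndex (pilotDataOfK D K)).Fibre (.inr pp)),
      haveI : Fact (pp : ℕ).Prime := ⟨pp.2⟩
      placeOf (pilotDataOfK D K) pp.1 x₀ ∈ (pilotDataOfK D K).S ∧
      ((pp : ℕ) : ℝ) ^ ((((i : ℕ) : ℝ) + 2) * (4 + 2 * Real.logb (pp : ℕ) (Module.finrank ℚ K)) + 1) *
        (((pp : ℕ) : ℝ) ^ ((ord K (placeOf (pilotDataOfK D K) pp.1 x₀) (algebraMap F K E.j) : ℝ) /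
          (2 * l * ramIdx K (placeOf (pilotDataOfK D K) pp.1 x₀)))) ^ (((i : ℕ) + 1) ^ 2 - 1) < 1) := by
  rintro ⟨pp, hp2, i, x₀, hS, hlt⟩
  haveI : Fact (pp : ℕ).Prime := ⟨pp.2⟩
  have hp1 : (1 : ℝ) < ((pp : ℕ) : ℝ) := by exact_mod_cast pp.2.one_lt
  have hN : (1 : ℝ) ≤ (Module.finrank ℚ K : ℝ) := by exact_mod_cast Module.finrank_pos
  have hL : 0 ≤ Real.logb (pp : ℕ) (Module.finrank ℚ K) := Real.logb_nonneg hp1 hN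
  have he : (0 : ℝ) ≤ (ramIdx K (placeOf (pilotDataOfK D K) pp.1 x₀) : ℝ) := Nat.cast_nonneg _
  have hi : (i : ℕ) < (pilotDataOfK D K).lstar := i.2
  have hleq : (pilotDataOfK D K).l = 2 * (pilotDataOfK D K).lstar + 1 := (pilotDataOfK D K).l_eq
  have hlK : (pilotDataOfK D K).l = l := pilotDataOfK_l D K
  have hil : 2 * ((i : ℕ) : ℝ) + 3 ≤ (l : ℝ) := by
    have : 2 * (i : ℕ) + 3 ≤ l := by omega
    exact_mod_cast this
  exact absurd hlt (not_lt.mpr (one_le_depthProduct_of_neg_mul_le hp1 hL he D.five_le_l (hw pp x₀ hS) hil))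

/-- **The same on the CHOSEN realising q-idele** (the `Deep` form of the v8K/v10K window and of `H⋆₂`'s window guard): under the per-place bound
`(−ord_{x₀}(j_E))·(l−3)(l+1) ≤ 8l(2l+3)·e_{x₀}` at the bad places, the degree-form depth inequality holds at NO packet (`GenuineK.deep_iff_deepOrd`).
[claim: Mochizuki2012, status: disputed] [cite: DupuyHilado2025, §3.4] -/
theorem not_deep_of_neg_ord_jE_mul_le
    (hw : ∀ (pp : Nat.Primes) (x₀ : (thetaIndex (pilotDataOfK D K)).Fibre (.inr pp)),
      haveI : Fact (pp : ℕ).Prime := ⟨pp.2⟩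
      placeOf (pilotDataOfK D K) pp.1 x₀ ∈ (pilotDataOfK D K).S →
        (-(ord K (placeOf (pilotDataOfK D K) pp.1 x₀) (algebraMap F K E.j) : ℝ)) * (((l : ℝ) - 3) * ((l : ℝ) + 1)) ≤
          8 * (l : ℝ) * (2 * (l : ℝ) + 3) * ramIdx K (placeOf (pilotDataOfK D K) pp.1 x₀)) :
    ¬ (∃ (pp : Nat.Primes) (_ : 2 < (pp : ℕ)) (i : Fin (thetaIndex (pilotDataOfK D K)).lstar)
        (x₀ : (thetaIndex (pilotDataOfK D K)).Fibre (.inr pp)),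
      haveI : Fact (pp : ℕ).Prime := ⟨pp.2⟩
      ((pp : ℕ) : ℝ) ^ ((((i : ℕ) : ℝ) + 2) * (4 + 2 * Real.logb (pp : ℕ) (Module.finrank ℚ K)) + 1) *
        ‖(exists_realising_qIdeles_pilotDataOfK D).choose pp x₀‖ ^ (((i : ℕ) + 1) ^ 2 - 1) < 1) :=
  fun h => not_deepOrd_of_neg_ord_jE_mul_le D hw ((GenuineK.deep_iff_deepOrd D).mp h)

/-- **The cross-field identification, weighted form**: along `F_tpd ⊆ F ⊆ K` with `j(E_F) = j(λ)`, if every bad place `v` of `F_tpd` has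
`h_v·M ≤ c·e_v` (`M, c ≥ 0`), then EVERY finite place `x₀` of `K` has `(−ord_{x₀}(j_E))·M ≤ c·e_{x₀}` (`ord_{x₀}(j_E) = e(x₀|v₁)e(v₁|v)·ord_v(j(λ))`,
`e_{x₀} = e(x₀|v₁)e(v₁|v)·e_v`; at a place over a non-pole `−ord ≤ 0`). The case `M = 1, c = 16` is abc-iut-w4-d078's
`GenuineK.neg_ord_jE_le_of_forall_localHeight_le`. [cite: Mochizuki2012, IUTchI Def. 3.1 (b)(c) p. 61] [claim: Mochizuki2012, status: disputed] -/
theorem neg_ord_jE_mul_le_of_forall_localHeight_mul_le {P : NFPoint} [Algebra P.F F]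
    (hj : E.j = algebraMap P.F F (Cor22.jInv P.x)) {M c : ℝ} (hM : 0 ≤ M) (hc : 0 ≤ c)
    (hw : ∀ v ∈ Cor22.badPlaces P, Cor22.localHeight P v * M ≤ c * ramIdx P.F v) (x₀ : HeightOneSpectrum (𝓞 K)) :
    (-(ord K x₀ (algebraMap F K E.j) : ℝ)) * M ≤ c * ramIdx K x₀ := by
  set v₁ := finBelow F K x₀ with hv₁
  set v₀ := finBelow P.F F v₁ with hv₀
  have e₁pos : 0 < Ideal.ramificationIdx' v₁.asIdeal x₀.asIdeal := PilotData.ramificationIdx'_finBelow_pos (F := F) x₀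
  have e₀pos : 0 < Ideal.ramificationIdx' v₀.asIdeal v₁.asIdeal := PilotData.ramificationIdx'_finBelow_pos (F := P.F) v₁
  have hord : ord K x₀ (algebraMap F K E.j) =
      (Ideal.ramificationIdx' v₁.asIdeal x₀.asIdeal : ℤ) * ((Ideal.ramificationIdx' v₀.asIdeal v₁.asIdeal : ℤ) *
        ord P.F v₀ (Cor22.jInv P.x)) := by
    rw [hj, ord_algebraMap F K x₀, ord_algebraMap P.F F v₁]
  have hram : (ramIdx K x₀ : ℝ) =
      (ramIdx P.F v₀ : ℝ) * (Ideal.ramificationIdx' v₀.asIdeal v₁.asIdeal : ℝ) * (Ideal.ramificationIdx' v₁.asIdeal x₀.asIdeal : ℝ) := by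
    rw [ramIdx_eq_ramIdx_finBelow_mul (F := F) (K := K) x₀, ramIdx_eq_ramIdx_finBelow_mul (F := P.F) (K := F) v₁]
    push_cast
    ring
  have e₁r : (0 : ℝ) < (Ideal.ramificationIdx' v₁.asIdeal x₀.asIdeal : ℝ) := by exact_mod_cast e₁pos
  have e₀r : (0 : ℝ) < (Ideal.ramificationIdx' v₀.asIdeal v₁.asIdeal : ℝ) := by exact_mod_cast e₀pos
  have hr0 : (0 : ℝ) ≤ (ramIdx P.F v₀ : ℝ) := Nat.cast_nonneg _
  have hprod : (0 : ℝ) ≤ (Ideal.ramificationIdx' v₁.asIdeal x₀.asIdeal : ℝ) * (Ideal.ramificationIdx' v₀.asIdeal v₁.asIdeal : ℝ) :=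
    mul_nonneg e₁r.le e₀r.le
  rw [hord, hram]
  push_cast
  by_cases hneg : ord P.F v₀ (Cor22.jInv P.x) < 0
  · -- a bad place below: `h_{v₀}·M ≤ c·e_{v₀}`
    have hv₀bad : v₀ ∈ Cor22.badPlaces P := (Cor22.mem_badPlaces_iff_ord_neg P v₀).mpr hneg
    have hh := hw v₀ hv₀bad
    rw [Cor22.localHeight_eq_neg_ord hv₀bad] at hh
    have key := mul_le_mul_of_nonneg_left hh hprod
    nlinarith [key]
  · -- a good place below: `−ord ≤ 0`
    have h0 : (0 : ℝ) ≤ (ord P.F v₀ (Cor22.jInv P.x) : ℝ) := by exact_mod_cast not_lt.mp hneg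
    have h1 : (0 : ℝ) ≤ (Ideal.ramificationIdx' v₁.asIdeal x₀.asIdeal : ℝ) * ((Ideal.ramificationIdx' v₀.asIdeal v₁.asIdeal : ℝ) *
        (ord P.F v₀ (Cor22.jInv P.x) : ℝ)) * M := mul_nonneg (mul_nonneg e₁r.le (mul_nonneg e₀r.le h0)) hM
    have h2 : (0 : ℝ) ≤ c * ((ramIdx P.F v₀ : ℝ) * (Ideal.ramificationIdx' v₀.asIdeal v₁.asIdeal : ℝ) *
        (Ideal.ramificationIdx' v₁.asIdeal x₀.asIdeal : ℝ)) := mul_nonneg hc (mul_nonneg (mul_nonneg hr0 e₀r.le) e₁r.le)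
    nlinarith

end PerDatum

/-- **WINDOW-PERMANENCE at a `λ`-line point, `l`-sharp.** If every bad place `v` of `F_tpd` has `h_v·(l−3)(l+1) ≤ 8l(2l+3)·e_v`, then for EVERY
genuine Θ-volume datum `T` at `(P, l)` the window guard of `H⋆₂` / of the binder `hSHwBad` of p450130 — `¬ (∃ pp > 2, i, x₀, p^{…}·‖t_{q,x₀}‖^{(i+1)²−1} < 1)`
on the chosen realising q-idele of `T.D` — HOLDS, VERBATIM (`T.j_eq` supplies `j(E_F) = j(λ)`, `T.D.five_le_l` the range `l ≥ 5`). At a rational point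
(`e_v = 1`) the hypothesis reads `max_v h_v ≤ 8l(2l+3)/((l−3)(l+1))` (`29.75 / 22.9 / 21.5 / 19.9 / 19.5` at `l = 7 / 11 / 13 / 17 / 19`).
[cite: Mochizuki2012, IUTchIII Cor. 3.12 p. 173–174; IUTchIV Thm. 1.10 p. 22–23] [claim: Mochizuki2012, status: disputed] -/
theorem not_deep_of_forall_localHeight_mul_le {P : NFPoint} {l : ℕ} (T : Cor22.ThetaVolumeDatumAt P l)
    (hw : ∀ v ∈ Cor22.badPlaces P, Cor22.localHeight P v * (((l : ℝ) - 3) * ((l : ℝ) + 1)) ≤ 8 * (l : ℝ) * (2 * (l : ℝ) + 3) * ramIdx P.F v) :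
    letI := T.instFieldF; letI := T.instNumberFieldF; letI := T.instAlgebraF; letI := T.instFieldK
    letI := T.instNumberFieldK; letI := T.instAlgebraK; letI := T.instFieldFbar; letI := T.instAlgebraFbar
    letI := T.instAlgebraKFbar; letI := T.instIsElliptic
    ¬ (∃ (pp : Nat.Primes) (_ : 2 < (pp : ℕ)) (i : Fin (thetaIndex (pilotDataOfK T.D T.K)).lstar)
        (x₀ : (thetaIndex (pilotDataOfK T.D T.K)).Fibre (.inr pp)),
      haveI : Fact (pp : ℕ).Prime := ⟨pp.2⟩
      ((pp : ℕ) : ℝ) ^ ((((i : ℕ) : ℝ) + 2) * (4 + 2 * Real.logb (pp : ℕ) (Module.finrank ℚ T.K)) + 1) *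
        ‖(exists_realising_qIdeles_pilotDataOfK T.D).choose pp x₀‖ ^ (((i : ℕ) + 1) ^ 2 - 1) < 1) := by
  letI := T.instFieldF; letI := T.instNumberFieldF; letI := T.instAlgebraF; letI := T.instFieldK
  letI := T.instNumberFieldK; letI := T.instAlgebraK; letI := T.instFieldFbar; letI := T.instAlgebraFbar
  letI := T.instAlgebraKFbar; letI := T.instIsElliptic
  have h5 : (5 : ℝ) ≤ l := by exact_mod_cast T.D.five_le_l
  have hM : (0 : ℝ) ≤ ((l : ℝ) - 3) * ((l : ℝ) + 1) := by nlinarith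
  have hc : (0 : ℝ) ≤ 8 * (l : ℝ) * (2 * (l : ℝ) + 3) := by positivity
  exact not_deep_of_neg_ord_jE_mul_le T.D fun pp x₀ _ =>
    neg_ord_jE_mul_le_of_forall_localHeight_mul_le (K := T.K) T.j_eq hM hc hw _

/-! ## §2. Rational points with a reduced odd pole divisor: (P2), (P5), the window hypothesis, and the SZPIRO-BAD certificate -/

section RatPoint

open Rat.HeightOneSpectrum Literature.NumberTheory.DiophantineGeometry.UniformABCConjecture

variable {q : ℚ} {N Dn : ℕ} {I : Finset ℕ} {e : ℕ → ℕ}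

/-- **(P2) at a rational point from the factorised pole divisor**: `j(q) = N/∏_{p∈I} p^{e_p}` (`p ∤ N` for `p ∈ I`); if `l ∤ e_p` for every `p ∈ I`
then (P2) «`l` divides no nonzero local height» holds at `(ratPoint q, l)` (`ord_v j(q) = −e_{p_v}` at a pole, `≥ 0` elsewhere — abc-iut-c312-d1's
dictionary). [cite: Mochizuki2012, IUTchIV Cor. 2.2 (ii) proof (P2) p. 45] [claim: Mochizuki2012, status: disputed] -/
theorem condP2_ratPoint_of_factorisation (hI : ∀ p ∈ I, p.Prime) (hD : Dn = ∏ p ∈ I, p ^ e p)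
    (hj : Cor22.jInv q = (N : ℚ) / (Dn : ℚ)) (hN : N ≠ 0) (hcop : ∀ p ∈ I, ¬ p ∣ N) {l : ℕ} (hl : ∀ p ∈ I, ¬ l ∣ e p) :
    Cor22.CondP2 (ratPoint q) l := by
  show ∀ v : HeightOneSpectrum (𝓞 ℚ), ord ℚ v (Cor22.jInv q) < 0 → ¬ ((l : ℤ) ∣ ord ℚ v (Cor22.jInv q))
  intro v hv hdvd
  by_cases hmem : natGenerator v ∈ I
  · rw [Cor22.ord_jInv_ratPoint_of_mem hI hD hj hN v hmem (hcop _ hmem)] at hdvd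
    exact hl _ hmem (by exact_mod_cast (dvd_neg.mp hdvd))
  · exact absurd hv (not_lt.mpr (Cor22.ord_jInv_ratPoint_nonneg_of_not_mem hI hD hj hN v hmem))

/-- **(P5) at a rational point from the factorised pole divisor**: a prime `p₀ ∈ I` with `p₀ ∤ 2`, `p₀ ∤ l` gives a bad place of `F_tpd = ℚ`
(a pole of `j(q)`) dividing neither `2` nor `l`. [cite: Mochizuki2012, IUTchIV Cor. 2.2 (ii) proof (P5) p. 46] [claim: Mochizuki2012, status: disputed] -/
theorem condP5_ratPoint_of_factorisation (hI : ∀ p ∈ I, p.Prime) (he : ∀ p ∈ I, e p ≠ 0) (hD : Dn = ∏ p ∈ I, p ^ e p)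
    (hj : Cor22.jInv q = (N : ℚ) / (Dn : ℚ)) (hN : N ≠ 0) (hcop : ∀ p ∈ I, ¬ p ∣ N) {l p₀ : ℕ} (hp₀ : p₀ ∈ I)
    (hp₀2 : ¬ p₀ ∣ 2) (hp₀l : ¬ p₀ ∣ l) : Cor22.CondP5 (ratPoint q) l := by
  classical
  have hS : ∀ s ∈ ({2, l} : Finset ℕ), ¬ p₀ ∣ s := by
    intro s hs
    simp only [Finset.mem_insert, Finset.mem_singleton] at hs
    rcases hs with rfl | rfl
    · exact hp₀2
    · exact hp₀l
  have hv := Cor22.primesEquiv_symm_mem_badPlacesAvoid_ratPoint hI he hD hj hN {2, l} hp₀ (hcop p₀ hp₀) hS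
  obtain ⟨hbad, hnot⟩ := Finset.mem_filter.1 hv
  exact ⟨_, (Cor22.mem_badPlaces_iff_ord_neg (ratPoint q) _).1 hbad, hnot 2 (by simp), hnot l (by simp)⟩

/-- **The `l`-sharp window hypothesis at a rational point from the factorised pole divisor**: if `e_p·M ≤ c` for every `p ∈ I` (`c ≥ 0`), then every
bad place `v` of `ratPoint q` has `h_v·M ≤ c·e_v` (`h_v = e_{p_v}`, `e_v ≥ 1`). [cite: MochizukiGenEll2010, Def. 3.3 p. 12] [claim: Mochizuki2012, status: disputed] -/
theorem localHeight_mul_le_ratPoint_of_factorisation (hI : ∀ p ∈ I, p.Prime) (hD : Dn = ∏ p ∈ I, p ^ e p)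
    (hj : Cor22.jInv q = (N : ℚ) / (Dn : ℚ)) (hN : N ≠ 0) (hcop : ∀ p ∈ I, ¬ p ∣ N) {M c : ℝ} (hc : 0 ≤ c)
    (hle : ∀ p ∈ I, (e p : ℝ) * M ≤ c) :
    ∀ v : HeightOneSpectrum (𝓞 ℚ), v ∈ Cor22.badPlaces (ratPoint q) →
      Cor22.localHeight (ratPoint q) v * M ≤ c * ramIdx ℚ v := by
  intro v hv
  have hneg : ord ℚ v (Cor22.jInv q) < 0 := (Cor22.mem_badPlaces_iff_ord_neg (ratPoint q) v).1 hv
  have hmem : natGenerator v ∈ I := by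
    by_contra h
    exact absurd hneg (not_lt.mpr (Cor22.ord_jInv_ratPoint_nonneg_of_not_mem hI hD hj hN v h))
  rw [Cor22.localHeight_ratPoint_eq hI hD hj hN v hmem (hcop _ hmem)]
  have h1 : (1 : ℝ) ≤ (ramIdx ℚ v : ℝ) := by
    exact_mod_cast Nat.one_le_iff_ne_zero.mpr (ramIdx_ne_zero ℚ v)
  calc (e (natGenerator v) : ℝ) * M ≤ c := hle _ hmem
    _ = c * 1 := (mul_one c).symm
    _ ≤ c * ramIdx ℚ v := mul_le_mul_of_nonneg_left h1 hc

/-- The real arithmetic of the Szpiro-bad certificate: with `l ≥ 5`, `6(l+1)(l−1) ≤ A(l+4)(l−3)`, `6l(l+5) ≤ B(l+4)(l−3)`, `S₁ ≥ 0`,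
`0 ≤ L_π ≤ L₄` and `A·S₁ + B·L₄ < S₂`: `6l(l+5−4)/((l+4)(l−3))·(0 + (1−1/l)·S₁) + 6l(l+5)/((l+4)(l−3))·L_π < S₂`. [folklore] -/
theorem szpiroBad_arith {l A B S₁ S₂ Lπ L₄ : ℝ} (hl5 : 5 ≤ l) (hA : 6 * (l + 1) * (l - 1) ≤ A * ((l + 4) * (l - 3)))
    (hB : 6 * l * (l + 5) ≤ B * ((l + 4) * (l - 3))) (hS1 : 0 ≤ S₁) (hLπ0 : 0 ≤ Lπ) (hLπ : Lπ ≤ L₄)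
    (key : A * S₁ + B * L₄ < S₂) :
    6 * l * ((l + 5) - 4 * 1) / ((l + 4) * (l - 3)) * (0 + (1 - 1 / l) * S₁) + 6 * l * (l + 5) / ((l + 4) * (l - 3)) * Lπ < S₂ := by
  have hM : 0 < (l + 4) * (l - 3) := by nlinarith
  have hl0 : 0 < l := by linarith
  have hB0 : 0 ≤ B := by
    have : 0 < 6 * l * (l + 5) := by positivity
    nlinarith
  have hcoef1 : 6 * l * ((l + 5) - 4 * 1) / ((l + 4) * (l - 3)) * (1 - 1 / l) ≤ A := by
    rw [div_mul_eq_mul_div, div_le_iff₀ hM]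
    have e1 : 6 * l * ((l + 5) - 4 * 1) * (1 - 1 / l) = 6 * (l + 1) * (l - 1) := by
      field_simp
      ring
    rw [e1]
    exact hA
  have hcoef2 : 6 * l * (l + 5) / ((l + 4) * (l - 3)) ≤ B := by
    rw [div_le_iff₀ hM]
    exact hB
  have h1 : 6 * l * ((l + 5) - 4 * 1) / ((l + 4) * (l - 3)) * (0 + (1 - 1 / l) * S₁) ≤ A * S₁ := by
    rw [zero_add, ← mul_assoc]
    exact mul_le_mul_of_nonneg_right hcoef1 hS1
  have h2 : 6 * l * (l + 5) / ((l + 4) * (l - 3)) * Lπ ≤ B * L₄ :=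
    (mul_le_mul_of_nonneg_right hcoef2 hLπ0).trans (mul_le_mul_of_nonneg_left hLπ hB0)
  linarith

/-- **THE SZPIRO-BAD CERTIFICATE at a rational point.** `j(q) = N/∏_{p∈I} p^{e_p}` with `I` odd primes, `e_p ≥ 1`, `p ∤ N` on `I`; `l ≥ 5` prime;
natural numbers `A, B` with `6(l+1)(l−1) ≤ A(l+4)(l−3)`, `6l(l+5) ≤ B(l+4)(l−3)`; and ONE inequality of natural numbers
`(∏_{p∈I∖{l}} p)^A · 4^B < ∏_{p∈I∖{l}} p^{e_p}`. THEN the Szpiro-bad disjunction of the cut certificate of record p450130 (= the extra antecedent of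
`H⋆₂`, of `hSHwBad`, `hNumBad`) HOLDS at `(ratPoint q, l)`: `d_mod = 1` (abc-iut-S3), `log-diff = 0`, `log 𝔣^{∤2l} = Σ_{I∖{l}} log p`,
`log q^{∤2l} = Σ_{I∖{l}} e_p log p` (abc-iut-c312-d1's dictionary p462751), `log π < log 4`. [cite: Mochizuki2012, IUTchIV Thm. 1.10 p. 22–23,
Cor. 2.2 (ii) proof p. 46] [claim: Mochizuki2012, status: disputed] -/
theorem szpiroBad_ratPoint_of_certificate (hI : ∀ p ∈ I, p.Prime) (he : ∀ p ∈ I, e p ≠ 0) (hD : Dn = ∏ p ∈ I, p ^ e p)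
    (hj : Cor22.jInv q = (N : ℚ) / (Dn : ℚ)) (hN : N ≠ 0) (hcop : ∀ p ∈ I, ¬ p ∣ N) (h2 : 2 ∉ I) {l : ℕ} (hl : l.Prime)
    (h5 : 5 ≤ l) {A B : ℕ} (hA : 6 * ((l : ℝ) + 1) * ((l : ℝ) - 1) ≤ A * (((l : ℝ) + 4) * ((l : ℝ) - 3)))
    (hB : 6 * (l : ℝ) * ((l : ℝ) + 5) ≤ B * (((l : ℝ) + 4) * ((l : ℝ) - 3)))
    (hcert : (∏ p ∈ I.erase l, p) ^ A * 4 ^ B < ∏ p ∈ I.erase l, p ^ e p) :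
    ((l : ℝ) + 5) / 4 < (Cor22.dmod (ratPoint q) : ℝ) ∨
      6 * l * (((l : ℝ) + 5) - 4 * Cor22.dmod (ratPoint q)) / (((l : ℝ) + 4) * ((l : ℝ) - 3))
          * ((ratPoint q).logDiff + (1 - 1 / (l : ℝ)) * Cor22.logCondAvoid (ratPoint q) {2, l})
        + 6 * l * ((l : ℝ) + 5) / (((l : ℝ) + 4) * ((l : ℝ) - 3)) * Real.log Real.pi < Cor22.logQAvoid (ratPoint q) {2, l} := by
  right
  have hd : Cor22.dmod (ratPoint q) = 1 := Cor22.dmod_eq_one_of_degree_le_one (le_of_eq (degree_ratPoint q))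
  rw [hd, logDiff_ratPoint, Cor22.logCondAvoid_ratPoint_two_prime_eq_sum hI he hD hj hN hcop h2 hl,
    Cor22.logQAvoid_ratPoint_two_prime_eq_sum hI he hD hj hN hcop h2 hl, Nat.cast_one]
  have hl5 : (5 : ℝ) ≤ l := by exact_mod_cast h5
  have hJ : ∀ p ∈ I.erase l, (0 : ℝ) < p := fun p hp => by
    exact_mod_cast (hI p (Finset.mem_of_mem_erase hp)).pos
  have hS1 : 0 ≤ ∑ p ∈ I.erase l, Real.log (p : ℝ) :=
    Finset.sum_nonneg fun p hp => Real.log_nonneg (by exact_mod_cast (hI p (Finset.mem_of_mem_erase hp)).one_lt.le)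
  have hlog4 : Real.log Real.pi ≤ Real.log 4 := Real.log_le_log Real.pi_pos Real.pi_lt_four.le
  have hlogpi0 : 0 ≤ Real.log Real.pi := Real.log_nonneg (by linarith [Real.pi_gt_three])
  -- the certificate in logarithms
  have key : (A : ℝ) * (∑ p ∈ I.erase l, Real.log (p : ℝ)) + B * Real.log 4 < ∑ p ∈ I.erase l, (e p : ℝ) * Real.log (p : ℝ) := by
    have hprod : (0 : ℝ) < ∏ p ∈ I.erase l, (p : ℝ) := Finset.prod_pos hJ
    have hlhs : (0 : ℝ) < (∏ p ∈ I.erase l, (p : ℝ)) ^ A * 4 ^ B := by positivity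
    have hcast : (((∏ p ∈ I.erase l, p) ^ A * 4 ^ B : ℕ) : ℝ) < ((∏ p ∈ I.erase l, p ^ e p : ℕ) : ℝ) := by
      exact_mod_cast hcert
    push_cast at hcast
    have hlog := Real.log_lt_log hlhs hcast
    rw [Real.log_mul (pow_pos hprod _).ne' (by positivity), Real.log_pow, Real.log_pow,
      Real.log_prod (fun p hp => (hJ p hp).ne'), Real.log_prod (fun p hp => (pow_pos (hJ p hp) _).ne')] at hlog
    simpa only [Real.log_pow] using hlog
  exact szpiroBad_arith hl5 hA hB hS1 hlogpi0 hlog4 key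

end RatPoint

end Summit.ABC.IUTFork.Repair.RHSzpiroBadCutFreyResidue

end
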